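import Mathlib
import Literature.NumberTheory.Transcendental.KZCalculusProofs
import Literature.NumberTheory.Transcendental.SemialgebraicMapsProofs
import Literature.NumberTheory.Transcendental.KZSemialgebraicComplex

/-!
# `OffTetraSectorKernel`, line `odd-hyperbolic-ladder`: the similarity move in every dimension

Stub `stub_similarityMove` of the crux `OffTetraSectorKernel` (stmt-KontsevichZagierPeriods-10557,
route HyperbolicBloch). In the upper half-space model `ℝⁿ × ℝ₊` of hyperbolic `(n+1)`-space
(coordinates `p : Fin (n + 1) → ℝ`, boundary point `x = Fin.init p`, height `t = p (Fin.last n)`)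
a boundary-fixing similarity `g : p ↦ (c • A x + b, c t)` with `c > 0`, `A` orthogonal (`Aᵀ A = 1`)
and `c, A, b` real algebraic is a hyperbolic isometry, and we show that it is ONE
Kontsevich–Zagier change-of-variables move (rule (2), `KZ.changeOfVariablesRel`) for the
invariant density `t^{-(n+1)}`: for every integral representation `r = [σ, t^{-(n+1)}]` with
`σ ⊆ {t > 0}` and every representation `r'` with domain `g '' σ` and integrand `t^{-(n+1)}` there,
`KZ.Equivalent r r'`.

The four data of the move:
* `g` is a `ℚ`-semialgebraic map on `σ` (each coordinate is real-affine with real-algebraic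
  coefficients, which are `ℚ`-definable constants);
* `g` is injective (`A` is invertible, `c ≠ 0`);
* `g` is affine, `g p = L p + (b, 0)` with constant linear part `L p = (c • A x, c t)`, so
  `HasFDerivWithinAt g L σ p`;
* `det L = c^{n+1} det A` (Laplace expansion along the last row) and `(det A)² = 1`, so
  `|det L| = c^{n+1}` and the Jacobian identity `t^{-(n+1)} = (c t)^{-(n+1)} · |det L|` holds.

References: R. Benedetti, C. Petronio, *Lectures on Hyperbolic Geometry* (1992), A.3.5;
M. Kontsevich, D. Zagier, *Periods* (2001), §1.2 rule (2); J. Bochnak, M. Coste, M.-F. Roy,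
*Real Algebraic Geometry* (1998), Prop. 2.2.6.
-/

noncomputable section

open Set MeasureTheory
open Literature.NumberTheory.Transcendental Literature.ModelTheory.ExponentialFields

namespace Summit.KontsevichZagierPeriods.HyperbolicBloch.OffTetraSectorKernel

/-- Finite sums of `ℚ`-semialgebraic real functions on a `ℚ`-semialgebraic set are
`ℚ`-semialgebraic. [cite: BochnakCosteRoy1998, Prop. 2.2.6] -/
theorem isSemialgebraicFunOn_finset_sum {m : ℕ} {s : Set (Fin m → ℝ)} (hs : IsSemialgebraic ℚ s)
    {ι : Type*} (S : Finset ι) {f : ι → (Fin m → ℝ) → ℝ}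
    (hf : ∀ i ∈ S, IsSemialgebraicFunOn ℚ s (f i)) :
    IsSemialgebraicFunOn ℚ s (fun x => ∑ i ∈ S, f i x) := by
  classical
  induction S using Finset.induction_on with
  | empty => simpa using isSemialgebraicFunOn_const_of_isAlgebraic hs isAlgebraic_zero
  | insert a S ha ih =>
    have h1 := hf a (Finset.mem_insert_self a S)
    have h2 := ih fun i hi => hf i (Finset.mem_insert_of_mem hi)
    exact (IsSemialgebraicFunOn.add_holds h1 h2).congr fun x _ => by simp [Finset.sum_insert ha]

/-- The boundary similarity `p ↦ (c • A x + b, c t)` with real-algebraic `c, A, b` is a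
`ℚ`-semialgebraic map on every `ℚ`-semialgebraic `σ`: its coordinates are real-affine functions with
real-algebraic (hence `ℚ`-definable) coefficients. [cite: BochnakCosteRoy1998, Prop. 2.2.6] -/
theorem simil_isSemialgebraicMapOn {n : ℕ} {c : ℝ} {A : Matrix (Fin n) (Fin n) ℝ} {b : Fin n → ℝ}
    (hc : IsAlgebraic ℚ c) (hA : ∀ i j, IsAlgebraic ℚ (A i j)) (hb : ∀ i, IsAlgebraic ℚ (b i))
    {σ : Set (Fin (n + 1) → ℝ)} (hσ : IsSemialgebraic ℚ σ) :
    IsSemialgebraicMapOn ℚ σ (fun p : Fin (n + 1) → ℝ =>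
      (Fin.snoc (α := fun _ => ℝ) (c • A.mulVec (Fin.init p) + b) (c * p (Fin.last n)) :
        Fin (n + 1) → ℝ)) := by
  -- coordinates are semialgebraic
  have hcoord : ∀ i : Fin (n + 1), IsSemialgebraicFunOn ℚ σ (fun p => p i) := fun i => by
    simpa using isSemialgebraicFunOn_aeval hσ (MvPolynomial.X i : MvPolynomial (Fin (n + 1)) ℚ)
  refine IsSemialgebraicMapOn.of_forall hσ fun j => ?_
  induction j using Fin.lastCases with
  | last =>
    -- last coordinate `c * t`
    exact (IsSemialgebraicFunOn.mul_holds (isSemialgebraicFunOn_const_of_isAlgebraic hσ hc)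
      (hcoord (Fin.last n))).congr fun p _ => by simp
  | cast i =>
    -- coordinate `i`: `c * ∑ k, A i k * p k.castSucc + b i`
    have hsum : IsSemialgebraicFunOn ℚ σ (fun p => ∑ k : Fin n, A i k * p k.castSucc) :=
      isSemialgebraicFunOn_finset_sum hσ Finset.univ fun k _ =>
        (IsSemialgebraicFunOn.mul_holds (isSemialgebraicFunOn_const_of_isAlgebraic hσ (hA i k))
          (hcoord k.castSucc)).congr fun p _ => rfl
    exact (IsSemialgebraicFunOn.add_holds (IsSemialgebraicFunOn.mul_holds
      (isSemialgebraicFunOn_const_of_isAlgebraic hσ hc) hsum)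
      (isSemialgebraicFunOn_const_of_isAlgebraic hσ (hb i))).congr fun p _ => by
        simp [Matrix.mulVec, dotProduct, Fin.init]

/-- The boundary similarity `p ↦ (c • A x + b, c t)` with `c ≠ 0` and `Aᵀ A = 1` is injective
(cancel `c`, then apply `Aᵀ`). [folklore] -/
theorem simil_injective {n : ℕ} {c : ℝ} {A : Matrix (Fin n) (Fin n) ℝ} (b : Fin n → ℝ)
    (hc : c ≠ 0) (hA : A.transpose * A = 1) :
    Function.Injective (fun p : Fin (n + 1) → ℝ =>
      (Fin.snoc (α := fun _ => ℝ) (c • A.mulVec (Fin.init p) + b) (c * p (Fin.last n)) :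
        Fin (n + 1) → ℝ)) := by
  intro p q hpq
  have hlast : c * p (Fin.last n) = c * q (Fin.last n) := by
    simpa using congrFun hpq (Fin.last n)
  have hinit : c • A.mulVec (Fin.init p) + b = c • A.mulVec (Fin.init q) + b := by
    have := congrArg Fin.init hpq
    simpa only [Fin.init_snoc] using this
  have h1 : A.mulVec (Fin.init p) = A.mulVec (Fin.init q) :=
    smul_right_injective (Fin n → ℝ) hc (add_right_cancel hinit)
  have h2 : Fin.init p = Fin.init q := by
    have := congrArg A.transpose.mulVec h1
    simpa [Matrix.mulVec_mulVec, hA] using this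
  calc p = Fin.snoc (Fin.init p) (p (Fin.last n)) := (Fin.snoc_init_self p).symm
    _ = Fin.snoc (Fin.init q) (q (Fin.last n)) := by rw [h2, mul_left_cancel₀ hc hlast]
    _ = q := Fin.snoc_init_self q

/-- The linear part `L p = (c • A x, c t)` of the boundary similarity, as a continuous linear map,
and its determinant `det L = c^{n+1} det A` (Laplace expansion along the last row). [folklore] -/
theorem simil_exists_linearPart (n : ℕ) (c : ℝ) (A : Matrix (Fin n) (Fin n) ℝ) :
    ∃ L : (Fin (n + 1) → ℝ) →L[ℝ] (Fin (n + 1) → ℝ),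
      (∀ p, L p = Fin.snoc (α := fun _ => ℝ) (c • A.mulVec (Fin.init p)) (c * p (Fin.last n))) ∧
      L.det = c ^ (n + 1) * A.det := by
  let M : Matrix (Fin (n + 1)) (Fin (n + 1)) ℝ := Matrix.of fun i j =>
    Fin.lastCases (Fin.lastCases c (fun _ => 0) j)
      (fun i' => Fin.lastCases 0 (fun j' => c * A i' j') j) i
  have hMll : M (Fin.last n) (Fin.last n) = c := by simp [M]
  have hMlc : ∀ j', M (Fin.last n) (Fin.castSucc j') = 0 := fun j' => by simp [M]
  have hMcl : ∀ i', M (Fin.castSucc i') (Fin.last n) = 0 := fun i' => by simp [M]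
  have hMcc : ∀ i' j', M (Fin.castSucc i') (Fin.castSucc j') = c * A i' j' := fun i' j' => by
    simp [M]
  refine ⟨LinearMap.toContinuousLinearMap (Matrix.toLin' M), fun p => ?_, ?_⟩
  · rw [LinearMap.coe_toContinuousLinearMap', Matrix.toLin'_apply]
    ext i
    induction i using Fin.lastCases with
    | last => simp [Matrix.mulVec, dotProduct, Fin.sum_univ_castSucc, hMll, hMlc]
    | cast i' =>
      simp [Matrix.mulVec, dotProduct, Fin.sum_univ_castSucc, hMcl, hMcc, Fin.init, Finset.mul_sum,
        mul_assoc]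
  · rw [LinearMap.det_toContinuousLinearMap, LinearMap.det_toLin', Matrix.det_succ_row M (Fin.last n),
      Fin.sum_univ_castSucc]
    have hsub : M.submatrix Fin.castSucc Fin.castSucc = c • A := by
      ext i' j'
      simp [hMcc]
    have hsign : (-1 : ℝ) ^ (n + n) = 1 := by
      rw [← two_mul, pow_mul, neg_one_sq, one_pow]
    simp only [hMlc, mul_zero, zero_mul, Finset.sum_const_zero, zero_add, hMll, Fin.val_last, hsign,
      one_mul, Fin.succAbove_last, hsub, Matrix.det_smul, Fintype.card_fin]
    ring

/-- **Similarity move** (stub `stub_similarityMove` of line `odd-hyperbolic-ladder`). A boundary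
similarity `g : (x, t) ↦ (c • A x + b, c t)` of the upper half-space `ℝⁿ × ℝ₊` with `c > 0`,
`Aᵀ A = 1` and `c, A, b` real algebraic is one Kontsevich–Zagier change-of-variables move for the
density `t^{-(n+1)}`: if `r = [σ, t^{-(n+1)}]` with `σ ⊆ {t > 0}` and `r'` has domain `g '' σ` and
integrand `t^{-(n+1)}` there, then `[r] − [r'] ∈ KZ.changeOfVariablesRel`, so `KZ.Equivalent r r'`
(`g` is `ℚ`-semialgebraic and injective on `σ`, with constant derivative `L`, `|det L| = c^{n+1}`,
and `t^{-(n+1)} = (c t)^{-(n+1)} c^{n+1}`). [cite: BenedettiPetronio1992, A.3.5] -/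
theorem stub_similarityMove : ∀ (n : ℕ), ∀ (c : ℝ) (A : Matrix (Fin n) (Fin n) ℝ) (b : Fin n → ℝ), IsAlgebraic ℚ c → 0 < c → (∀ i j, IsAlgebraic ℚ (A i j)) → A.transpose * A = 1 → (∀ i, IsAlgebraic ℚ (b i)) → ∀ (r r' : Literature.NumberTheory.Transcendental.KZ.IntegralRep (n + 1)), r.domain ⊆ {p : Fin (n + 1) → ℝ | 0 < p (Fin.last n)} → Set.EqOn r.integrand (fun p : Fin (n + 1) → ℝ => 1 / p (Fin.last n) ^ (n + 1)) r.domain → r'.domain = (fun p : Fin (n + 1) → ℝ => (Fin.snoc (α := fun _ => ℝ) (c • A.mulVec (Fin.init p) + b) (c * p (Fin.last n)) : Fin (n + 1) → ℝ)) '' r.domain → Set.EqOn r'.integrand (fun p : Fin (n + 1) → ℝ => 1 / p (Fin.last n) ^ (n + 1)) r'.domain → Literature.NumberTheory.Transcendental.KZ.Equivalent r r' := by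
  intro n c A b hc hc0 hA hAA hb r r' hpos hint hdom hint'
  set Φ : (Fin (n + 1) → ℝ) → (Fin (n + 1) → ℝ) := fun p : Fin (n + 1) → ℝ =>
    (Fin.snoc (α := fun _ => ℝ) (c • A.mulVec (Fin.init p) + b) (c * p (Fin.last n)) :
      Fin (n + 1) → ℝ) with hΦ
  obtain ⟨L, hL, hLdet⟩ := simil_exists_linearPart n c A
  -- `|det A| = 1` from `Aᵀ A = 1`
  have hdetA : |A.det| = 1 := by
    have h := congrArg Matrix.det hAA
    rw [Matrix.det_mul, Matrix.det_transpose, Matrix.det_one] at h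
    have h' : |A.det| * |A.det| = 1 := by rw [← abs_mul, h, abs_one]
    rcases mul_self_eq_one_iff.mp h' with h'' | h''
    · exact h''
    · exact absurd h'' (by have := abs_nonneg A.det; linarith)
  have hLabs : |L.det| = c ^ (n + 1) := by
    rw [hLdet, abs_mul, hdetA, mul_one, abs_of_pos (pow_pos hc0 _)]
  -- `Φ` is affine with linear part `L`
  have hΦL : Φ = fun p => L p + Fin.snoc (α := fun _ => ℝ) b 0 := by
    funext p
    rw [hL]
    ext i
    induction i using Fin.lastCases with
    | last => simp [hΦ]
    | cast i' => simp [hΦ]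
  have hderiv : ∀ x, HasFDerivAt Φ L x := fun x => by
    rw [hΦL]
    exact L.hasFDerivAt.add_const _
  refine KZ.changeOfVariablesRel_subset_relations
    ⟨n + 1, r, r', Φ, fun _ => L, simil_isSemialgebraicMapOn hc hA hb r.isSemialgebraic_domain,
      fun x _ => (hderiv x).hasFDerivWithinAt, (simil_injective b hc0.ne' hAA).injOn, hdom,
      fun x hx => ?_, rfl⟩
  -- the Jacobian identity `t^{-(n+1)} = (c t)^{-(n+1)} · c^{n+1}`
  have hx' : Φ x ∈ r'.domain := hdom ▸ mem_image_of_mem Φ hx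
  have h1 : r.integrand x = 1 / x (Fin.last n) ^ (n + 1) := hint hx
  have h2 : r'.integrand (Φ x) = 1 / (Φ x) (Fin.last n) ^ (n + 1) := hint' hx'
  have hΦx : Φ x (Fin.last n) = c * x (Fin.last n) := by simp [hΦ]
  rw [hΦx] at h2
  have hx0 : x (Fin.last n) ≠ 0 := ne_of_gt (hpos hx)
  have hc' : c ≠ 0 := hc0.ne'
  show r.integrand x = r'.integrand (Φ x) * |L.det|
  rw [h1, h2, hLabs]
  field_simp
  ring

end Summit.KontsevichZagierPeriods.HyperbolicBloch.OffTetraSectorKernel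

end
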